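import Summits.BirchSwinnertonDyer.BirchSwinnertonDyer.Theorems.EisensteinPrimesMazurMCOnCellBKummerCharacterCountOfTorsion
import HarnessLib

/-!
# The Kummer-character count WITH the cyclotomic character adjoined: `p^{b+2k} ≤ p · #V` suffices
# (route `EisensteinPrimes`, crux 3 `MazurMCOnCellB` = stmt-BirchSwinnertonDyer-19033, line `mudescent`,
# stub 4″ `stub_lambdaCountWeak_offLocus`, ALGEBRAIC half; width seat bsd-line-x2-p1-w3, D-0154 row 5)

HONEST FRAMING (cell `bsd-eis`; nothing here proves BSD or a main conjecture; 0 cells move): THEOREMS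
ONLY — no definition, no named fact, nothing asserted about any particular curve, closes nothing.
Sequel of p630234 / p630799 (`…KummerCharacterCount[OfTorsion]`): there the certified characters are
TRIVIAL on `Γ_{ℚ_p}`; the one character the user cannot supply is the mod-`p` CYCLOTOMIC character
`κ̄ = κ mod p` of the `κ` quantified inside `GeneratorCountGE`. Its class `[σ ↦ κ̄(σ)·P̃]` is unramified
away from `p` (tree `X2.GreenbergVatsalUnramifiedAway.inertia_le_kerSubgroup_of_isCyclotomic`) and at
`p` dies over `ℚ_{∞,π}` (lam-b's local kernel class, `EisensteinPrimesX2SplitTorsionLocalKernelClass`).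
This file adjoins it INSIDE the proof: §1 `resH1Hom_localSubgroup_eq_zero_of_trivial_on_ker` (a
character of `Γ_{K_v}` trivial on `Gal(K̄_v/K_v K_∞)` gives a localisation restricting to `0` there —
the `K_∞`-condition of `EisensteinPrimesX2GeneratorCountAtP` §1 with `ξ` the class itself) and
`exists_modP_character` (`κ̄`); §2 `generatorCountGE_of_kummerCharacters_succ` — hypotheses VERBATIM
those of p630234's socket, conclusion for **`p^{b+2k} ≤ p · #V`** (`S = θ(V·⟨κ̄⟩) ≅ V × ℤ/p`, injective
because `V` is trivial on `Γ_{ℚ_p}` while `κ̄` hits the generator on the inertia group at `p`, tree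
`X2.GreenbergVatsalStrictAtPQuotient.exists_mem_inertia_kappa_eq`); §3 the X2 corollaries at
`p ∣ #E(ℚ)_tors` with `hΨ` discharged (p630799): **`AlgebraicLambdaGE W p (b − m)` for
`p^{b + 2·v_p(#E(ℚ)_tors)} ≤ p · #V`** at a `μ_an ≤ m` member — at the étale end with `#V = p^d`,
`λ ≥ d − 1`. References: [GreenbergLNM1716] §3 Lemma 3.1, pp. 85–93, §5 proof of Prop. 5.10, p. 137;
[GreenbergVatsal2000] §2 pp. 14–15; [Washington1997] §13.1; [Wuthrich2014] Thm. 16.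
-/

set_option autoImplicit false
-- `Summit.BirchSwinnertonDyer.BirchSwinnertonDyer.…`: the summit and its single sub-problem share a name (D-0017 layout).
set_option linter.dupNamespace false

noncomputable section

open scoped Classical

open Function Field NumberField IsDedekindDomain WeierstrassCurve
  Literature.NumberTheory.EllipticCurves Literature.NumberTheory.GaloisRepresentations
  Literature.NumberTheory.EllipticCurves.Rank1Residual Literature.NumberTheory.EllipticCurves.ModularForms
  Summit.BirchSwinnertonDyer.Rank1Residual
  Summit.BirchSwinnertonDyer.Rank1Residual.X1.GeneratorCountSqueeze
  Summit.BirchSwinnertonDyer.Rank1Residual.X1.TamagawaSqueeze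
  Summit.BirchSwinnertonDyer.BirchSwinnertonDyer.Theorems.EisensteinPrimesAlgebraicLambdaGEBudget
  Summit.BirchSwinnertonDyer.BirchSwinnertonDyer.Theorems.EisensteinPrimesX2GeneratorCountAtP
  Summit.BirchSwinnertonDyer.BirchSwinnertonDyer.Theorems.EisensteinPrimesX2AlgebraicLambdaGESplitTorsion
  Summit.BirchSwinnertonDyer.BirchSwinnertonDyer.Theorems.EisensteinPrimesMazurMCOnCellBKummerCharacterCocycles
  Summit.BirchSwinnertonDyer.BirchSwinnertonDyer.Theorems.EisensteinPrimesMazurMCOnCellBKummerPlaceClasses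
  Summit.BirchSwinnertonDyer.BirchSwinnertonDyer.Theorems.EisensteinPrimesMazurMCOnCellBKummerCharacterCount
  Summit.BirchSwinnertonDyer.BirchSwinnertonDyer.Theorems.EisensteinPrimesMazurMCOnCellBKummerCharacterCountOfTorsion

universe u

namespace Summit.BirchSwinnertonDyer.BirchSwinnertonDyer.Theorems.EisensteinPrimesMazurMCOnCellBKummerCharacterCountSucc

/-! ## §1. Local lemmas: vanishing over `K_∞`; the mod-`p` character `κ̄` -/

section Local

variable {K : Type} [Field K] [NumberField K] (W : WeierstrassCurve K) {p : ℕ} [hp : Fact p.Prime]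
  (κ : ZpExtension K p) (v : HeightOneSpectrum (𝓞 K))

/-- **A character trivial on `Gal(K̄_v/K_v K_∞)` gives a class dying over `K_{∞,η}`**: for `φ` with
`φ(res σ) = ψ_v(σ)·P̃` and `ψ_v = 1` wherever `κ ∘ res = 1`, the image of `res_v [φ]` in
`H¹(Γ_{K_v}, E(K̄_v))` restricts to `0` on `localSubgroup (ker κ) K_v` (the cocycle vanishes there) — the
hypothesis `hξ` of `EisensteinPrimesX2GeneratorCountAtP` §1 for the class itself.
[cite: GreenbergLNM1716, §3 Lemma 3.1 and pp. 91–93] -/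
theorem resH1Hom_localSubgroup_eq_zero_of_trivial_on_ker (Pt : geomTorsion W (p : ℤ))
    (ψv : absoluteGaloisGroup (v.adicCompletion K) →ₜ* Multiplicative (ZMod p))
    (hψ : ∀ g : absoluteGaloisGroup (v.adicCompletion K),
      κ (resGal (K := K) (v.adicCompletion K) g) = 1 → ψv g = 1)
    (φ : contOneCocycles (discreteTopRep (absoluteGaloisGroup K) (geomTorsion W (p : ℤ))))
    (hφ : ∀ σ : absoluteGaloisGroup (v.adicCompletion K),
      φ.1 (resGal (K := K) (v.adicCompletion K) σ) = (Multiplicative.toAdd (ψv σ)).val • Pt) :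
    resH1Hom (Literature.NumberTheory.EllipticCurves.subgroupIncl
        (localSubgroup κ.kerSubgroup (v.adicCompletion K)))
      (AddMonoidHom.id (localPoints W (v.adicCompletion K))) (fun _ _ ↦ rfl)
      (galoisCohomology.map (W.torsionPointsMapIntertwining (p : ℤ) (v.adicCompletion K)) 1
        (galoisCohomology.res (W.torsionGaloisModule (p : ℤ)) (v.adicCompletion K) 1
          (oneCocycleClass (discreteTopRep (absoluteGaloisGroup K) (geomTorsion W (p : ℤ))) φ))) = 0 := by
  set Kv := v.adicCompletion K with hKv
  rw [WeierstrassCurve.res_torsionGaloisModule_oneCocycleClass]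
  set φloc := contOneCocycles.pullback (absGaloisRestrict K Kv)
      (X := discreteTopRep (absoluteGaloisGroup K) (geomTorsion W (p : ℤ)))
      (Y := DiscreteGaloisModule.toTopRep (GaloisRep.restrictField Kv (W.torsionGaloisModule (p : ℤ))))
      (TopRep.ofHom ⟨ContinuousLinearMap.id ℤ (geomTorsion W (p : ℤ)), fun _ => rfl⟩) φ with hφloc
  rw [W.map_torsionPointsMapIntertwining_oneCocycleClass (p : ℤ) Kv φloc]
  set ψ := contOneCocycles.pullback (ContinuousMonoidHom.id (absoluteGaloisGroup Kv))
      (X := DiscreteGaloisModule.toTopRep (GaloisRep.restrictField Kv (W.torsionGaloisModule (p : ℤ))))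
      (Y := discreteTopRep (absoluteGaloisGroup Kv) (localPoints W Kv))
      (TopRep.ofHom ⟨(W.torsionPointsMapIntertwining (p : ℤ) Kv).toContinuousLinearMap,
        (W.torsionPointsMapIntertwining (p : ℤ) Kv).isIntertwining'⟩) φloc with hψdef
  have key : resH1Hom (Literature.NumberTheory.EllipticCurves.subgroupIncl (localSubgroup κ.kerSubgroup Kv))
      (AddMonoidHom.id (localPoints W Kv)) (fun _ _ ↦ rfl)
      (oneCocycleClass (discreteTopRep (absoluteGaloisGroup Kv) (localPoints W Kv)) ψ) =
      oneCocycleClass _ (contOneCocycles.pullback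
        (Literature.NumberTheory.EllipticCurves.subgroupIncl (localSubgroup κ.kerSubgroup Kv))
        (resHomOfEquivariant
          (Literature.NumberTheory.EllipticCurves.subgroupIncl (localSubgroup κ.kerSubgroup Kv))
          (AddMonoidHom.id (localPoints W Kv)) (fun _ _ ↦ rfl)) ψ) :=
    map_oneCocycleClass _ _ _ ψ
  rw [key]
  refine (oneCocycleClass_eq_zero_iff _ _).mpr ⟨0, fun g ↦ ?_⟩
  have hg : κ (resGal (K := K) Kv (g : absoluteGaloisGroup Kv)) = 1 := by
    rw [← ZpExtension.mem_kerSubgroup]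
    exact (mem_localSubgroup_iff κ.kerSubgroup Kv g).mp g.2
  rw [contOneCocycles.pullback_apply, hψdef, contOneCocycles.pullback_apply, map_zero, sub_zero]
  change (W.torsionPointsMapIntertwining (p : ℤ) Kv) (φloc.1 (g : absoluteGaloisGroup Kv)) = 0
  rw [hφloc, contOneCocycles.pullback_apply]
  change (W.torsionPointsMapIntertwining (p : ℤ) Kv) (φ.1 (resGal (K := K) Kv (g : absoluteGaloisGroup Kv))) = 0
  rw [hφ, hψ _ hg, toAdd_one, ZMod.val_zero, zero_smul, map_zero]

omit [NumberField K] in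
/-- **The mod-`p` character `κ̄ : Γ_K →ₜ* ℤ/p` of a `ℤ_p`-extension `κ`** (`PadicInt.toZModPow 1`
then `ZMod.castHom`): `κ̄ σ = 1` when `κ σ = 1`, and `κ̄ σ = ofAdd 1` when `κ σ = ofAdd 1` (the
topological generator). Existence with these two values; no definition. [cite: Washington1997, §13.1] -/
theorem exists_modP_character :
    ∃ κbar : absoluteGaloisGroup K →ₜ* Multiplicative (ZMod p),
      (∀ σ, κ σ = 1 → κbar σ = 1) ∧
      (∀ σ, κ σ = Multiplicative.ofAdd 1 → κbar σ = Multiplicative.ofAdd 1) := by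
  let rbar : ℤ_[p] →+ ZMod p :=
    (ZMod.castHom (dvd_pow_self p one_ne_zero) (ZMod p)).toAddMonoidHom.comp
      (PadicInt.toZModPow 1 : ℤ_[p] →+* ZMod (p ^ 1)).toAddMonoidHom
  have hrbar_cont : Continuous rbar :=
    (continuous_of_discreteTopology (f := (ZMod.castHom (dvd_pow_self p one_ne_zero) (ZMod p))))
      |>.comp (PadicInt.continuous_toZModPow p 1)
  refine ⟨{ toFun := fun σ ↦ Multiplicative.ofAdd (rbar (Multiplicative.toAdd (κ σ)))
            map_one' := by rw [map_one, toAdd_one, map_zero, ofAdd_zero]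
            map_mul' := fun a b ↦ by rw [map_mul, toAdd_mul, map_add, ofAdd_add]
            continuous_toFun := continuous_ofAdd.comp (hrbar_cont.comp (continuous_toAdd.comp
              κ.toContinuousMonoidHom.continuous)) }, fun σ hσ ↦ ?_, fun σ hσ ↦ ?_⟩
  · change Multiplicative.ofAdd (rbar (Multiplicative.toAdd (κ σ))) = 1
    rw [hσ, toAdd_one, map_zero, ofAdd_zero]
  · change Multiplicative.ofAdd (rbar (Multiplicative.toAdd (κ σ))) = Multiplicative.ofAdd 1
    rw [hσ, toAdd_ofAdd]
    congr 1
    change (ZMod.castHom (dvd_pow_self p one_ne_zero) (ZMod p)) (PadicInt.toZModPow 1 (1 : ℤ_[p])) = 1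
    rw [map_one, map_one]

end Local

/-! ## §2. Over `ℚ`: the count with the cyclotomic character adjoined — `p^{b+2k} ≤ p · #V` -/

section Rat

variable {W : WeierstrassCurve ℚ} [W.IsElliptic] [W.IsGloballyMinimal] {p : ℕ} [hp : Fact p.Prime]

/-- **The Kummer-character count with `κ̄` adjoined: `GeneratorCountGE W p b` for `p^{b+2k} ≤ p·#V`.**
Hypotheses verbatim those of p630234's `generatorCountGE_of_kummerCharacters`; inside, the mod-`p`
cyclotomic character `κ̄` of the given `κ` is adjoined: `S = θ(V·⟨κ̄⟩)` has order `p·#V` (`V ∩ ⟨κ̄⟩ = 1`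
on the inertia group at `p`) and each `χ·κ̄ⁿ` is admissible (at `p` by §1, elsewhere `κ̄` is unramified).
[cite: GreenbergLNM1716, §3 pp. 85–93, §5 proof of Prop. 5.10, p. 137] [cite: Washington1997, §13.1] -/
theorem generatorCountGE_of_kummerCharacters_succ (hodd : p ≠ 2)
    (hfix : ∀ κ : ZpExtension ℚ p, κ.IsCyclotomic →
      Finite (FixedPoints.addSubgroup κ.kerSubgroup (W.geomPrimaryTorsion p)))
    {k : ℕ}
    (hB : Nat.card {a : geomPrimaryTorsion W p // ∀ σ : absoluteGaloisGroup ℚ, σ • a = a} ≤ p ^ k)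
    (Pt : geomTorsion W (p : ℤ)) (hPt : ∀ σ : absoluteGaloisGroup ℚ, σ • Pt = Pt) (hPt0 : Pt ≠ 0)
    (hΨ : ∀ Q : geomTorsion W (p : ℤ),
      (∀ σ : absoluteGaloisGroup ℚ, σ • Q - Q ∈ AddSubgroup.zmultiples Pt) →
        Q ∈ AddSubgroup.zmultiples Pt)
    (T : Finset (HeightOneSpectrum (𝓞 ℚ))) (hTbad : ∀ v, ¬ W.HasGoodReductionAt v → v ∈ T)
    (hTp : ∀ v : HeightOneSpectrum (𝓞 ℚ), ((p : ℕ) : 𝓞 ℚ) ∈ v.asIdeal → v ∈ T)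
    (V : Subgroup (absoluteGaloisGroup ℚ →ₜ* Multiplicative (ZMod p))) [Finite V]
    (hVp : ∀ χ ∈ V, ∀ v : HeightOneSpectrum (𝓞 ℚ), ((p : ℕ) : 𝓞 ℚ) ∈ v.asIdeal →
      ∀ σ : absoluteGaloisGroup (v.adicCompletion ℚ), χ (resGal (K := ℚ) (v.adicCompletion ℚ) σ) = 1)
    (hV : ∀ χ ∈ V, ∀ v : HeightOneSpectrum (𝓞 ℚ), ((p : ℕ) : 𝓞 ℚ) ∉ v.asIdeal →
      (∀ τ ∈ absInertia (v.adicCompletion ℚ), χ (resGal (K := ℚ) (v.adicCompletion ℚ) τ) = 1) ∨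
      (W.HasSplitMultiplicativeReductionAt v ∧ ∀ x : v.adicCompletion ℚ,
        Valued.v (algebraMap ℚ (v.adicCompletion ℚ) W.j) ≠ Valued.v x ^ p))
    {b : ℕ} (hb : p ^ (b + 2 * k) ≤ p * Nat.card V) : GeneratorCountGE W p b := by
  haveI : NeZero p := ⟨hp.out.ne_zero⟩
  intro κ γ hκ _ _ D _ _
  haveI := hfix κ hκ
  obtain ⟨κbar, hκ1, hκ2⟩ := exists_modP_character κ
  set vp : HeightOneSpectrum (𝓞 ℚ) := (Rat.HeightOneSpectrum.primesEquiv (R := 𝓞 ℚ)).symm ⟨p, hp.out⟩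
    with hvpdef
  have hvp : ((p : ℕ) : 𝓞 ℚ) ∈ vp.asIdeal :=
    (natCast_mem_asIdeal_iff_eq_primesEquiv_symm vp hp.out).mpr hvpdef
  obtain ⟨y₀, hy₀, hκy₀⟩ := X2.GreenbergVatsalStrictAtPQuotient.exists_mem_inertia_kappa_eq κ vp hκ hvp
    (Multiplicative.ofAdd 1)
  obtain ⟨σ₀, -, rfl⟩ := Subgroup.mem_map.mp hy₀
  have hκσ₀ : κbar (resGal (K := ℚ) (vp.adicCompletion ℚ) σ₀) = Multiplicative.ofAdd 1 := hκ2 _ hκy₀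
  have hκunr : ∀ v : HeightOneSpectrum (𝓞 ℚ), ((p : ℕ) : 𝓞 ℚ) ∉ v.asIdeal →
      ∀ τ ∈ absInertia (v.adicCompletion ℚ), κbar (resGal (K := ℚ) (v.adicCompletion ℚ) τ) = 1 :=
    fun v hpv τ hτ ↦ hκ1 _ (ZpExtension.mem_kerSubgroup.mp
      (X2.GreenbergVatsalUnramifiedAway.inertia_le_kerSubgroup_of_isCyclotomic κ v hκ hpv
        (Subgroup.mem_map.mpr ⟨τ, hτ, rfl⟩)))
  choose φ hφ using fun χ : absoluteGaloisGroup ℚ →ₜ* Multiplicative (ZMod p) ↦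
    exists_cocycle_of_character W χ Pt hPt
  have hpPt : p • Pt = 0 := Subtype.ext (by
    rw [AddSubgroupClass.coe_nsmul, ZeroMemClass.coe_zero]
    exact AddSubgroup.torsionBy.nsmul_iff.mp Pt.2)
  have hφ_mul : ∀ χ₁ χ₂ : absoluteGaloisGroup ℚ →ₜ* Multiplicative (ZMod p),
      φ (χ₁ * χ₂) = φ χ₁ + φ χ₂ := fun χ₁ χ₂ ↦ by
    apply Subtype.ext
    refine ContinuousMap.ext fun σ ↦ ?_
    rw [Submodule.coe_add, ContinuousMap.add_apply, hφ, hφ, hφ, ContinuousMonoidHom.mul_apply, toAdd_mul,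
      ZMod.val_add, ← nsmul_eq_mod_nsmul _ hpPt, add_nsmul]
  have hφ_one : φ 1 = 0 := by
    apply Subtype.ext
    refine ContinuousMap.ext fun σ ↦ ?_
    rw [Submodule.coe_zero, ContinuousMap.zero_apply, hφ, ContinuousMonoidHom.coe_one, Pi.one_apply, toAdd_one,
      ZMod.val_zero, zero_smul]
  let θ : (absoluteGaloisGroup ℚ →ₜ* Multiplicative (ZMod p)) →* Multiplicative (galH1Torsion W (p : ℤ)) :=
    { toFun := fun χ ↦ Multiplicative.ofAdd
        (oneCocycleClass (discreteTopRep (absoluteGaloisGroup ℚ) (geomTorsion W (p : ℤ))) (φ χ))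
      map_one' := by rw [hφ_one, oneCocycleClass_zero]; rfl
      map_mul' := fun χ₁ χ₂ ↦ by rw [hφ_mul, oneCocycleClass_add]; rfl }
  have hθ : ∀ χ, Multiplicative.toAdd (θ χ) =
      oneCocycleClass (discreteTopRep (absoluteGaloisGroup ℚ) (geomTorsion W (p : ℤ))) (φ χ) :=
    fun χ ↦ rfl
  have hθinj : Function.Injective θ := by
    rw [← MonoidHom.ker_eq_bot_iff, Subgroup.eq_bot_iff_forall]
    intro χ hχ
    exact character_eq_one_of_oneCocycleClass_eq_zero W χ Pt hPt hPt0 hΨ (φ χ) (hφ χ)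
      (toAdd_eq_zero.mpr ((MonoidHom.mem_ker).mp hχ))
  -- the hom `g : V × ℤ/p → characters`, `(χ, c) ↦ χ · κ̄^c`, and `F = θ ∘ g`
  have hκp : κbar ^ p = 1 := by
    ext σ
    rw [ContinuousMonoidHom.coe_one, Pi.one_apply]
    simp only [ContinuousMonoidHom.pow_apply]
    rw [← ofAdd_toAdd (κbar σ), ← ofAdd_nsmul, nsmul_eq_mul, ZMod.natCast_self, zero_mul, ofAdd_zero]
  have hpow_val : ∀ a b : ZMod p, κbar ^ (a + b).val = κbar ^ a.val * κbar ^ b.val := fun a b ↦ by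
    rw [ZMod.val_add, ← pow_eq_pow_mod _ hκp, pow_add]
  let g : V × Multiplicative (ZMod p) →* (absoluteGaloisGroup ℚ →ₜ* Multiplicative (ZMod p)) :=
    { toFun := fun x ↦ (x.1 : absoluteGaloisGroup ℚ →ₜ* Multiplicative (ZMod p)) *
        κbar ^ (Multiplicative.toAdd x.2).val
      map_one' := by
        simp only [Prod.fst_one, Prod.snd_one, OneMemClass.coe_one, toAdd_one, ZMod.val_zero, pow_zero,
          mul_one]
      map_mul' := fun x y ↦ by
        simp only [Prod.fst_mul, Prod.snd_mul, Subgroup.coe_mul, toAdd_mul]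
        rw [hpow_val]
        exact mul_mul_mul_comm _ _ _ _ }
  have hg : ∀ x : V × Multiplicative (ZMod p), g x =
      (x.1 : absoluteGaloisGroup ℚ →ₜ* Multiplicative (ZMod p)) * κbar ^ (Multiplicative.toAdd x.2).val :=
    fun x ↦ rfl
  let F : V × Multiplicative (ZMod p) →* Multiplicative (galH1Torsion W (p : ℤ)) := θ.comp g
  -- `F` is injective: evaluate at `σ₀` (where `V` is trivial and `κ̄` is the generator), then use `θ`
  have hFinj : Function.Injective F := by
    intro x y hxy
    have h1 : g x = g y := hθinj hxy
    have h2 := congrArg (fun ψ : absoluteGaloisGroup ℚ →ₜ* Multiplicative (ZMod p) ↦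
      ψ (resGal (K := ℚ) (vp.adicCompletion ℚ) σ₀)) h1
    simp only [hg, ContinuousMonoidHom.mul_apply, ContinuousMonoidHom.pow_apply] at h2
    rw [hVp _ x.1.2 vp hvp, hVp _ y.1.2 vp hvp, one_mul, one_mul, hκσ₀, ← ofAdd_nsmul, ← ofAdd_nsmul,
      nsmul_one, nsmul_one, ZMod.natCast_zmod_val, ZMod.natCast_zmod_val, ofAdd_toAdd, ofAdd_toAdd] at h2
    have h3 : x.2 = y.2 := h2
    have h4 : (x.1 : absoluteGaloisGroup ℚ →ₜ* Multiplicative (ZMod p)) = y.1 := by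
      rw [hg, hg, h3] at h1
      exact mul_right_cancel h1
    exact Prod.ext (Subtype.ext h4) h3
  -- the subgroup `S = F(V × ℤ/p)` of `H¹(ℚ, E[p])`, of order `p · #V`
  let S : AddSubgroup (galH1Torsion W (p : ℤ)) := Subgroup.toAddSubgroup' F.range
  haveI hSfin : Finite S := by
    haveI : Finite F.range := Finite.of_surjective _ (MonoidHom.rangeRestrict_surjective F)
    exact Finite.of_equiv F.range (Equiv.refl _)
  have hScard : Nat.card S = p * Nat.card V := by
    have h1 : Nat.card S = Nat.card F.range := rfl
    rw [h1, ← Nat.card_congr (MonoidHom.ofInjective hFinj).toEquiv, Nat.card_prod, mul_comm]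
    congr 1
    rw [Nat.card_congr Multiplicative.toAdd, Nat.card_zmod]
  have hSmem : ∀ y ∈ S, ∃ χ ∈ V, ∃ n : ℕ,
      oneCocycleClass (discreteTopRep (absoluteGaloisGroup ℚ) (geomTorsion W (p : ℤ))) (φ (χ * κbar ^ n)) = y := by
    intro y hy
    obtain ⟨⟨χ, c⟩, hx⟩ := MonoidHom.mem_range.mp ((Subgroup.mem_toAddSubgroup' _ _).mp hy)
    exact ⟨χ, χ.2, (Multiplicative.toAdd c).val, congrArg Multiplicative.toAdd hx⟩
  -- admissible characters `ψ = χ · κ̄^n`, `χ ∈ V`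
  have hφloc : ∀ (ψ : absoluteGaloisGroup ℚ →ₜ* Multiplicative (ZMod p)) (v : HeightOneSpectrum (𝓞 ℚ))
      (σ : absoluteGaloisGroup (v.adicCompletion ℚ)),
      (φ ψ).1 (resGal (K := ℚ) (v.adicCompletion ℚ) σ) =
        (Multiplicative.toAdd ((ψ.comp (resGal (K := ℚ) (v.adicCompletion ℚ))) σ)).val • Pt :=
    fun ψ v σ ↦ hφ ψ _
  have hadm : ∀ χ ∈ V, ∀ (n : ℕ) (v : HeightOneSpectrum (𝓞 ℚ)), ((p : ℕ) : 𝓞 ℚ) ∉ v.asIdeal →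
      (∀ τ ∈ absInertia (v.adicCompletion ℚ), (χ * κbar ^ n) (resGal (K := ℚ) (v.adicCompletion ℚ) τ) = 1) ∨
      (W.HasSplitMultiplicativeReductionAt v ∧ ∀ x : v.adicCompletion ℚ,
        Valued.v (algebraMap ℚ (v.adicCompletion ℚ) W.j) ≠ Valued.v x ^ p) := by
    intro χ hχ n v hpv
    refine (hV χ hχ v hpv).imp (fun hur τ hτ ↦ ?_) id
    rw [ContinuousMonoidHom.mul_apply, ContinuousMonoidHom.pow_apply, hur τ hτ, hκunr v hpv τ hτ, one_pow,
      one_mul]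
  have hadp : ∀ χ ∈ V, ∀ (n : ℕ) (v : HeightOneSpectrum (𝓞 ℚ)), ((p : ℕ) : 𝓞 ℚ) ∈ v.asIdeal →
      ∀ σ : absoluteGaloisGroup (v.adicCompletion ℚ), κ (resGal (K := ℚ) (v.adicCompletion ℚ) σ) = 1 →
        ((χ * κbar ^ n).comp (resGal (K := ℚ) (v.adicCompletion ℚ))) σ = 1 := by
    intro χ hχ n v hpv σ hσ
    change (χ * κbar ^ n) (resGal (K := ℚ) (v.adicCompletion ℚ) σ) = 1
    rw [ContinuousMonoidHom.mul_apply, ContinuousMonoidHom.pow_apply, hVp χ hχ v hpv σ, hκ1 _ hσ, one_pow,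
      one_mul]
  -- at `v ∤ p`: the localisation is unramified or Kummer
  have hsup : ∀ χ ∈ V, ∀ (n : ℕ) (v : HeightOneSpectrum (𝓞 ℚ)), ((p : ℕ) : 𝓞 ℚ) ∉ v.asIdeal →
      galoisCohomology.res (W.torsionGaloisModule (p : ℤ)) (v.adicCompletion ℚ) 1
          (oneCocycleClass (discreteTopRep (absoluteGaloisGroup ℚ) (geomTorsion W (p : ℤ)))
            (φ (χ * κbar ^ n))) ∈
        DiscreteGaloisModule.unramifiedSubgroup
            ((W.torsionGaloisModule (p : ℤ)).restrictField (v.adicCompletion ℚ)) 1 ⊔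
          W.kummerLocalConditionAt (p : ℤ) (v.adicCompletion ℚ) := by
    intro χ hχ n v hpv
    rcases hadm χ hχ n v hpv with hur | ⟨hsplit, hj⟩
    · exact AddSubgroup.mem_sup_left (res_oneCocycleClass_mem_unramifiedSubgroup_of_inertia W v Pt
        ((χ * κbar ^ n).comp (resGal (K := ℚ) (v.adicCompletion ℚ))) hur (φ _) (hφloc _ v))
    · exact AddSubgroup.mem_sup_right (res_oneCocycleClass_mem_kummerLocalConditionAt_of_split W v hsplit
        hj Pt hPt ((χ * κbar ^ n).comp (resGal (K := ℚ) (v.adicCompletion ℚ))) (φ _) (hφloc _ v))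
  -- every class of `S` is admissible
  have hcount := X1.GeneratorCountTorsion.natCard_le_natCard_quotient_maximalIdeal_mul_sq W κ D S
    (↑T : Set (HeightOneSpectrum (𝓞 ℚ))) (fun y hy v hv ↦ by
      obtain ⟨χ, hχV, n, rfl⟩ := hSmem y hy
      have hvT : v ∉ T := fun h ↦ hv (Finset.mem_coe.mpr h)
      have hgood : W.HasGoodReductionAt v := by_contra fun h ↦ hvT (hTbad v h)
      have hpv : ((p : ℕ) : 𝓞 ℚ) ∉ v.asIdeal := fun h ↦ hvT (hTp v h)
      rw [← W.comap_res_kummerLocalConditionAt (p : ℤ) (v.adicCompletion ℚ)]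
      refine AddSubgroup.mem_comap.mpr ?_
      rcases hadm χ hχV n v hpv with hur | ⟨hsplit, hj⟩
      · exact X10.SelfTwist.unramifiedSubgroup_le_kummerLocalConditionAt_of_hasGoodReductionAt W hgood
          (p : ℤ) (res_oneCocycleClass_mem_unramifiedSubgroup_of_inertia W v Pt
            ((χ * κbar ^ n).comp (resGal (K := ℚ) (v.adicCompletion ℚ))) hur (φ _) (hφloc _ v))
      · exact res_oneCocycleClass_mem_kummerLocalConditionAt_of_split W v hsplit hj Pt hPt
          ((χ * κbar ^ n).comp (resGal (K := ℚ) (v.adicCompletion ℚ))) (φ _) (hφloc _ v))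
    (fun y _ w ↦ X11a.SelmerCompanion.mem_selmerLocalKer_infinitePlace_of_odd W hodd hp.out w y)
    fun y hy v _ ↦ by
      obtain ⟨χ, hχV, n, rfl⟩ := hSmem y hy
      by_cases hpv : ((p : ℕ) : 𝓞 ℚ) ∈ v.asIdeal
      · -- `ψ` is trivial on `Gal(ℚ̄_p/ℚ_{p,∞})`: the localisation dies over `ℚ_{∞,π}`
        exact layerToInfty_resH1Hom_torsionToPrimaryH1_mem_localKerOver_of_map_res_mem_zmultiples W p
          κ v _ (resH1Hom_localSubgroup_eq_zero_of_trivial_on_ker W κ v Pt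
            ((χ * κbar ^ n).comp (resGal (K := ℚ) (v.adicCompletion ℚ))) (hadp χ hχV n v hpv) (φ _)
            (hφloc _ v)) _ (AddSubgroup.mem_zmultiples _)
      · exact Additive.layerToInfty_resH1Hom_torsionToPrimaryH1_mem_localKerOver_of_mem_unramified_sup_kummer
          W p κ v hpv (Additive.exists_apply_resGal_ne_one_of_isCyclotomic κ hκ v hpv) _
          (hsup χ hχV n v hpv)
  have h1 : p ^ b * p ^ (2 * k) ≤ Nat.card (D.X ⧸ IsLocalRing.maximalIdeal (IwasawaAlgebra p) •
      (⊤ : Submodule (IwasawaAlgebra p) D.X)) * p ^ (2 * k) :=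
    calc p ^ b * p ^ (2 * k) = p ^ (b + 2 * k) := (pow_add p b (2 * k)).symm
      _ ≤ p * Nat.card V := hb
      _ = Nat.card S := hScard.symm
      _ ≤ _ := hcount
      _ ≤ Nat.card (D.X ⧸ IsLocalRing.maximalIdeal (IwasawaAlgebra p) •
            (⊤ : Submodule (IwasawaAlgebra p) D.X)) * (p ^ k) ^ 2 :=
          Nat.mul_le_mul_left _ (Nat.pow_le_pow_left hB 2)
      _ = _ := by rw [← pow_mul, mul_comm k 2]
  exact Nat.le_of_mul_le_mul_right h1 (pow_pos hp.out.pos _)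

/-! ## §3. X2 at `p ∣ #E(ℚ)_tors`: the count and the λ-bound with the «+1» -/

/-- **X2 Kummer-character count with `κ̄` adjoined**: `p` odd multiplicative, `p ∣ #E(ℚ)_tors`, `T`, `V`
as in §2 ⇒ `GeneratorCountGE W p b` for `p^{b + 2·v_p(#E(ℚ)_tors)} ≤ p · #V` (`P̃` from the torsion,
`hΨ` by p630799, `hfix`/`k` by the tree's torsion theorems). [cite: GreenbergLNM1716, §5 pp. 114–118, p. 137] -/
theorem X2.generatorCountGE_of_kummerCharacters_succ_of_dvd_torsionOrder (hodd : p ≠ 2)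
    (hmult : W.HasMultiplicativeReductionAtPrime p) (htors : p ∣ W.torsionOrder)
    (T : Finset (HeightOneSpectrum (𝓞 ℚ))) (hTbad : ∀ v, ¬ W.HasGoodReductionAt v → v ∈ T)
    (hTp : ∀ v : HeightOneSpectrum (𝓞 ℚ), ((p : ℕ) : 𝓞 ℚ) ∈ v.asIdeal → v ∈ T)
    (V : Subgroup (absoluteGaloisGroup ℚ →ₜ* Multiplicative (ZMod p))) [Finite V]
    (hVp : ∀ χ ∈ V, ∀ v : HeightOneSpectrum (𝓞 ℚ), ((p : ℕ) : 𝓞 ℚ) ∈ v.asIdeal →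
      ∀ σ : absoluteGaloisGroup (v.adicCompletion ℚ), χ (resGal (K := ℚ) (v.adicCompletion ℚ) σ) = 1)
    (hV : ∀ χ ∈ V, ∀ v : HeightOneSpectrum (𝓞 ℚ), ((p : ℕ) : 𝓞 ℚ) ∉ v.asIdeal →
      (∀ τ ∈ absInertia (v.adicCompletion ℚ), χ (resGal (K := ℚ) (v.adicCompletion ℚ) τ) = 1) ∨
      (W.HasSplitMultiplicativeReductionAt v ∧ ∀ x : v.adicCompletion ℚ,
        Valued.v (algebraMap ℚ (v.adicCompletion ℚ) W.j) ≠ Valued.v x ^ p))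
    {b : ℕ} (hb : p ^ (b + 2 * (W.torsionOrder).factorization p) ≤ p * Nat.card V) :
    GeneratorCountGE W p b := by
  obtain ⟨Pt, hPt0, hPt⟩ := exists_fixed_geomTorsion_of_dvd_torsionOrder W p htors
  exact generatorCountGE_of_kummerCharacters_succ hodd
    (fun κ hκ ↦ X2.GreenbergVatsalTransferMultiplicative.finite_fixedPoints_kerSubgroup_of_hasMultiplicativeReductionAtPrime
      W p TateCurve.Silverman1994_thmV53_corV54_tateUniformisation_holds hodd hmult κ hκ)
    (X1.GeneratorCountTorsion.natCard_fixedPoints_le_pow_factorization_torsionOrder W p) Pt hPt hPt0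
    (fun Q hQ ↦ mem_zmultiples_of_forall_smul_sub_mem W (eq_one_of_pow_eq_one_rat hodd) Pt hPt hPt0 Q hQ)
    T hTbad hTp V hVp hV hb

/-- **X2, the λ-bound with the «+1»: `AlgebraicLambdaGE W p (b − m)` for
`p^{b + 2·v_p(#E(ℚ)_tors)} ≤ p·#V` at a `μ_an ≤ m` member** (`p ‖ N` odd, `p ∣ #E(ℚ)_tors`; `h415`,
`hWu`, `hpar` as in p469158). Étale end, `#V = p^d`: `λ(X(E/ℚ_∞)) ≥ d − 1`.
[cite: GreenbergLNM1716, §5 pp. 114–118, p. 137, Prop. 4.15 (ii)] [cite: Wuthrich2014, Thm. 16 (p. 397)] -/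
theorem X2.algebraicLambdaGE_of_kummerCharacters_succ_of_dvd_torsionOrder (hodd : p ≠ 2)
    (h415 : Greenberg1999.prop415ii_noFiniteSubmodule_of_ordinary_or_multiplicative)
    (hWu : Wuthrich2014.thm16_charIdeal_dvd_multiplicative_of_reducible)
    (hpar : nonempty_modularParametrizationData)
    (hmult : W.HasMultiplicativeReductionAtPrime p) (htors : p ∣ W.torsionOrder)
    (T : Finset (HeightOneSpectrum (𝓞 ℚ))) (hTbad : ∀ v, ¬ W.HasGoodReductionAt v → v ∈ T)
    (hTp : ∀ v : HeightOneSpectrum (𝓞 ℚ), ((p : ℕ) : 𝓞 ℚ) ∈ v.asIdeal → v ∈ T)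
    (V : Subgroup (absoluteGaloisGroup ℚ →ₜ* Multiplicative (ZMod p))) [Finite V]
    (hVp : ∀ χ ∈ V, ∀ v : HeightOneSpectrum (𝓞 ℚ), ((p : ℕ) : 𝓞 ℚ) ∈ v.asIdeal →
      ∀ σ : absoluteGaloisGroup (v.adicCompletion ℚ), χ (resGal (K := ℚ) (v.adicCompletion ℚ) σ) = 1)
    (hV : ∀ χ ∈ V, ∀ v : HeightOneSpectrum (𝓞 ℚ), ((p : ℕ) : 𝓞 ℚ) ∉ v.asIdeal →
      (∀ τ ∈ absInertia (v.adicCompletion ℚ), χ (resGal (K := ℚ) (v.adicCompletion ℚ) τ) = 1) ∨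
      (W.HasSplitMultiplicativeReductionAt v ∧ ∀ x : v.adicCompletion ℚ,
        Valued.v (algebraMap ℚ (v.adicCompletion ℚ) W.j) ≠ Valued.v x ^ p))
    {m : ℕ} (hμ : X2.AnalyticMuLE W p m)
    {b : ℕ} (hb : p ^ (b + 2 * (W.torsionOrder).factorization p) ≤ p * Nat.card V) :
    AlgebraicLambdaGE W p (b - m) :=
  X2.algebraicLambdaGE_of_generatorCountGE_of_analyticMuLE hWu hpar h415 hodd hmult
    (not_hasIrreducibleModPGaloisRep_of_dvd_torsionOrder W p htors) hμ
    (X2.generatorCountGE_of_kummerCharacters_succ_of_dvd_torsionOrder hodd hmult htors T hTbad hTp V hVp hV hb)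

end Rat

end Summit.BirchSwinnertonDyer.BirchSwinnertonDyer.Theorems.EisensteinPrimesMazurMCOnCellBKummerCharacterCountSucc

end
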